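import Summits.CriticalPhenomena.PercolationContinuityZ3.Theorems.Transplant.FKConnectivityAllQPat3ThetaStarData3
import Summits.CriticalPhenomena.PercolationContinuityZ3.Theorems.Transplant.FKConnectivityAllQPat3RingStarData3
import Summits.CriticalPhenomena.PercolationContinuityZ3.Theorems.Transplant.FKConnectivityAllQSPMono
import Summits.CriticalPhenomena.PercolationContinuityZ3.Theorems.Transplant.FKConnectivityAllQPat3SPGoodDefs
import HarnessLib

/-!
# Connectivity correlation inequalities for `φ_{w,q}`, every `q > 0` — THEOREM SP on THETA and RING graphs: STAR with the apex on ANY piece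
# (census g36; relabelling / rotation corollaries of `FK.thetaStar_level_nonneg`, `FK.ringStar_level_nonneg`)

Theorems file (`--supports stmt-CriticalPhenomena-4575`), census lane `prim-bschramm-census` (gen 36) of the post-continuity programme (LANE 2 bschramm, FK sub-lane);
builds on p205010 (kernel theorem, internal audit signed; external expert review pending).
No definitions, no named facts, no sorries; standard axioms.  `FK.starSTab_eq_mirror` (`STAR_s` is the `x ↔ t` relabelling of
`STAR_x`), **`FK.thetaStar_apex₁_level_nonneg`** (`0 ≤ 17216 · lev2 (E_K ∪ E₁ ∪ E₂) b s t (mirror2 starXTab) λ`, apex `s`) and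
**`FK.thetaStar_apex₂_level_nonneg`** (`… starSTab …`, apex `t`): the THETA hypotheses are symmetric in the three pieces, so the
apex-`b` theorem applied to the permuted pieces plus `FK.lev2_swap_xy/_ys` gives the other two apices.  RING: `FK.starXTab_mirror23`,
(`FK.mirror23_mirror2_starXTab` of `…Pat3SPGoodDefs`), **`FK.ringStar_apex₁_level_nonneg`** (`mirror2 starXTab`, apex `s` on `Q₁`) and **`FK.ringStar_apex₂_level_nonneg`**
(`starSTab`, apex `t` on `Q₂`) by ROTATING the ring (`w ∉ V_K` and `b ≠ w` derived from `V_K ∩ V₁ ⊆ {u}`, `IsTTSP.right_mem`, `b ∉ V₁`).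
With the data theorems this makes THEOREM SP (T_sym and STAR, every apex) complete on THETA and RING gluings;
`FK.theta/ring_mval2_star_nonneg` restate the apex-`b` STAR results for every nonnegative level weight.
[cite: AyyerLinussonRavichandran2025, §7 eq. (13)–(15) (p. 22)]
-/

noncomputable section

namespace Summit.CriticalPhenomena.PercolationContinuityZ3.Theorems

namespace FK

open SimpleGraph Literature.Probability.LatticeModels Literature.Probability.Percolation


/-! ### STAR with the apex on the other pieces of a THETA graph (census g36) -/

section StarApex

/-- `STAR(s; x, y)` is the `x ↔ t`-relabelling of `STAR(x; y, s)`: `mirror2 (mirror23 (mirror2 starXTab)) = starSTab`. [folklore] -/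
theorem starSTab_eq_mirror : mirror2 (mirror23 (mirror2 starXTab)) = starSTab := by
  funext c P Q
  rcases c with _ | _ | c <;> cases P <;> cases Q <;> rfl

open scoped Classical

variable {V : Type*} [Fintype V]

/-- **THEOREM SP (THETA, STAR with apex on the SECOND piece):** `0 ≤ 17216 · lev2 (E_K ∪ E₁ ∪ E₂) b s t (mirror2 starXTab) λ`
(the member `STAR_y` of `famT12`, apex `s`), from `FK.thetaStar_level_nonneg` applied to the pieces in the order `(E₁, E_K, E₂)`
and the relabelling `FK.lev2_swap_xy`. [cite: AyyerLinussonRavichandran2025, §7 (p. 22)] -/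
theorem thetaStar_apex₁_level_nonneg {EK E₁ E₂ : Finset (Sym2 V)} {VK V₁ V₂ : Set V} {u v b s t : V}
    (hdK1 : Disjoint EK E₁) (hdK2 : Disjoint EK E₂) (hd12 : Disjoint E₁ E₂)
    (hK : ∀ e ∈ (↑EK : Set (Sym2 V)), ∀ z ∈ e, z ∈ VK)
    (h₁ : ∀ e ∈ (↑E₁ : Set (Sym2 V)), ∀ z ∈ e, z ∈ V₁) (h₂ : ∀ e ∈ (↑E₂ : Set (Sym2 V)), ∀ z ∈ e, z ∈ V₂)
    (hK1 : VK ∩ V₁ ⊆ ({u, v} : Set V)) (hK2 : VK ∩ V₂ ⊆ ({u, v} : Set V)) (h12 : V₁ ∩ V₂ ⊆ ({u, v} : Set V)) (huv : u ≠ v)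
    (hb1 : b ∉ V₁) (hb2 : b ∉ V₂) (hsK : s ∉ VK) (hs2 : s ∉ V₂) (htK : t ∉ VK) (ht1 : t ∉ V₁)
    (hbu : b ≠ u) (hbv : b ≠ v) (hsu : s ≠ u) (hsv : s ≠ v) (htu : t ≠ u) (htv : t ≠ v)
    (hbs : b ≠ s) (hbt : b ≠ t) (hst : s ≠ t)
    (hKsp : IsTTSP EK u v) (h1sp : IsTTSP E₁ u v) (h2sp : IsTTSP E₂ u v)
    (hbK : ∃ e ∈ EK, b ∈ e) (hs1 : ∃ e ∈ E₁, s ∈ e) (ht2 : ∃ e ∈ E₂, t ∈ e)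
    (lam : ℕ) : 0 ≤ ((17216 : ℕ) : ℤ) * lev2 (EK ∪ E₁ ∪ E₂) b s t (mirror2 starXTab) lam := by
  have h := thetaStar_level_nonneg hdK1.symm hd12 hdK2 h₁ hK h₂ (by rwa [Set.inter_comm]) h12 hK2 huv hsK hs2 hb1 hb2 ht1 htK
    hsu hsv hbu hbv htu htv (Ne.symm hbs) hst hbt h1sp hKsp h2sp hs1 hbK ht2 lam
  rwa [Finset.union_comm E₁ EK, lev2_swap_xy] at h

/-- **THEOREM SP (THETA, STAR with apex on the THIRD piece):** `0 ≤ 17216 · lev2 (E_K ∪ E₁ ∪ E₂) b s t starSTab λ` (apex `t`),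
from `FK.thetaStar_level_nonneg` applied to the pieces in the order `(E₂, E₁, E_K)` and the relabellings `FK.lev2_swap_xy`,
`FK.lev2_swap_ys`, `FK.starSTab_eq_mirror`. [cite: AyyerLinussonRavichandran2025, §7 (p. 22)] -/
theorem thetaStar_apex₂_level_nonneg {EK E₁ E₂ : Finset (Sym2 V)} {VK V₁ V₂ : Set V} {u v b s t : V}
    (hdK1 : Disjoint EK E₁) (hdK2 : Disjoint EK E₂) (hd12 : Disjoint E₁ E₂)
    (hK : ∀ e ∈ (↑EK : Set (Sym2 V)), ∀ z ∈ e, z ∈ VK)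
    (h₁ : ∀ e ∈ (↑E₁ : Set (Sym2 V)), ∀ z ∈ e, z ∈ V₁) (h₂ : ∀ e ∈ (↑E₂ : Set (Sym2 V)), ∀ z ∈ e, z ∈ V₂)
    (hK1 : VK ∩ V₁ ⊆ ({u, v} : Set V)) (hK2 : VK ∩ V₂ ⊆ ({u, v} : Set V)) (h12 : V₁ ∩ V₂ ⊆ ({u, v} : Set V)) (huv : u ≠ v)
    (hb1 : b ∉ V₁) (hb2 : b ∉ V₂) (hsK : s ∉ VK) (hs2 : s ∉ V₂) (htK : t ∉ VK) (ht1 : t ∉ V₁)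
    (hbu : b ≠ u) (hbv : b ≠ v) (hsu : s ≠ u) (hsv : s ≠ v) (htu : t ≠ u) (htv : t ≠ v)
    (hbs : b ≠ s) (hbt : b ≠ t) (hst : s ≠ t)
    (hKsp : IsTTSP EK u v) (h1sp : IsTTSP E₁ u v) (h2sp : IsTTSP E₂ u v)
    (hbK : ∃ e ∈ EK, b ∈ e) (hs1 : ∃ e ∈ E₁, s ∈ e) (ht2 : ∃ e ∈ E₂, t ∈ e)
    (lam : ℕ) : 0 ≤ ((17216 : ℕ) : ℤ) * lev2 (EK ∪ E₁ ∪ E₂) b s t starSTab lam := by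
  have h := thetaStar_level_nonneg hd12.symm hdK2.symm hdK1.symm h₂ h₁ hK (by rwa [Set.inter_comm]) (by rwa [Set.inter_comm])
    (by rwa [Set.inter_comm]) huv ht1 htK hs2 hsK hb2 hb1 htu htv hsu hsv hbu hbv (Ne.symm hst) (Ne.symm hbt) (Ne.symm hbs)
    h2sp h1sp hKsp ht2 hs1 hbK lam
  have hG : E₂ ∪ E₁ ∪ EK = EK ∪ E₁ ∪ E₂ := by
    rw [Finset.union_comm E₂ E₁, Finset.union_assoc, Finset.union_comm E₂ EK, ← Finset.union_assoc, Finset.union_comm E₁ EK]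
  rwa [hG, lev2_swap_xy, lev2_swap_ys, lev2_swap_xy, starSTab_eq_mirror] at h

end StarApex

/-! ### STAR with the apex on the other pieces of a RING (census g36) -/

section RingApex

/-- `STAR_x` is symmetric in its two non-apex marks: `mirror2 (mirror23 starXTab) = mirror2 starXTab`. [folklore] -/
theorem starXTab_mirror23 : mirror2 (mirror23 starXTab) = mirror2 starXTab := by
  funext c P Q
  rcases c with _ | _ | c <;> cases P <;> cases Q <;> rfl

open scoped Classical

variable {V : Type*} [Fintype V]

/-- **THEOREM SP (RING, STAR with apex on `Q₁`):** `0 ≤ 16 · lev2 (E_K ∪ E₁ ∪ E₂) b s t (mirror2 starXTab) λ` (apex `s`), from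
`FK.ringStar_level_nonneg` applied to the rotated ring `Q₁(u,w;s)·Q₂(w,v;t)·K(v,u;b)`; the rotation needs `w ∉ V_K` and `b ≠ w`,
derived from `V_K ∩ V₁ ⊆ {u}`, `w ∈ V₁` (`IsTTSP.right_mem`), `b ∉ V₁` (and does not need `v ∉ V₁`, `s ≠ v`). [cite: AyyerLinussonRavichandran2025, §7 (p. 22)] -/
theorem ringStar_apex₁_level_nonneg {EK E₁ E₂ : Finset (Sym2 V)} {VK V₁ V₂ : Set V} {u v w b s t : V}
    (hdK1 : Disjoint EK E₁) (hdK2 : Disjoint EK E₂) (hd12 : Disjoint E₁ E₂)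
    (hK : ∀ e ∈ (↑EK : Set (Sym2 V)), ∀ z ∈ e, z ∈ VK)
    (h₁ : ∀ e ∈ (↑E₁ : Set (Sym2 V)), ∀ z ∈ e, z ∈ V₁) (h₂ : ∀ e ∈ (↑E₂ : Set (Sym2 V)), ∀ z ∈ e, z ∈ V₂)
    (hK1 : VK ∩ V₁ ⊆ ({u} : Set V)) (h12 : V₁ ∩ V₂ ⊆ ({w} : Set V)) (hK2 : VK ∩ V₂ ⊆ ({v} : Set V))
    (hu2 : u ∉ V₂) (huv : u ≠ v) (huw : u ≠ w) (hvw : v ≠ w)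
    (hb1 : b ∉ V₁) (hb2 : b ∉ V₂) (hsK : s ∉ VK) (hs2 : s ∉ V₂) (htK : t ∉ VK) (ht1 : t ∉ V₁)
    (hbu : b ≠ u) (hbv : b ≠ v) (hsu : s ≠ u) (hsw : s ≠ w) (htu : t ≠ u) (htv : t ≠ v) (htw : t ≠ w)
    (hbs : b ≠ s) (hbt : b ≠ t) (hst : s ≠ t)
    (hKsp : IsTTSP EK v u) (h1sp : IsTTSP E₁ u w) (h2sp : IsTTSP E₂ w v)
    (hbK : ∃ e ∈ EK, b ∈ e) (hs1 : ∃ e ∈ E₁, s ∈ e) (ht2 : ∃ e ∈ E₂, t ∈ e)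
    (lam : ℕ) : 0 ≤ ((16 : ℕ) : ℤ) * lev2 (EK ∪ E₁ ∪ E₂) b s t (mirror2 starXTab) lam := by
  obtain ⟨e, he, hwe⟩ := h1sp.right_mem
  have hwV1 : w ∈ V₁ := h₁ e he w hwe
  have hwK : w ∉ VK := fun hw => huw (by have := hK1 ⟨hw, hwV1⟩; simpa using this.symm)
  have hbw : b ≠ w := fun hbw => hb1 (hbw ▸ hwV1)
  have h := ringStar_level_nonneg hd12 hdK1.symm hdK2.symm h₁ h₂ hK h12 (by rwa [Set.inter_comm]) (by rwa [Set.inter_comm])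
    hwK hu2 huw.symm hvw.symm huv hs2 hsK ht1 htK hb1 hb2 hsw hsu htw htu htv hbw hbu hbv hst (Ne.symm hbs) (Ne.symm hbt)
    h1sp h2sp hKsp hs1 ht2 hbK lam
  have hG : E₁ ∪ E₂ ∪ EK = EK ∪ E₁ ∪ E₂ := by
    rw [Finset.union_comm (E₁ ∪ E₂) EK, ← Finset.union_assoc]
  rwa [hG, lev2_swap_ys, lev2_swap_xy, starXTab_mirror23] at h

/-- **THEOREM SP (RING, STAR with apex on `Q₂`):** `0 ≤ 16 · lev2 (E_K ∪ E₁ ∪ E₂) b s t starSTab λ` (apex `t`), from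
`FK.ringStar_level_nonneg` applied to the rotated ring `Q₂(w,v;t)·K(v,u;b)·Q₁(u,w;s)`. [cite: AyyerLinussonRavichandran2025, §7 (p. 22)] -/
theorem ringStar_apex₂_level_nonneg {EK E₁ E₂ : Finset (Sym2 V)} {VK V₁ V₂ : Set V} {u v w b s t : V}
    (hdK1 : Disjoint EK E₁) (hdK2 : Disjoint EK E₂) (hd12 : Disjoint E₁ E₂)
    (hK : ∀ e ∈ (↑EK : Set (Sym2 V)), ∀ z ∈ e, z ∈ VK)
    (h₁ : ∀ e ∈ (↑E₁ : Set (Sym2 V)), ∀ z ∈ e, z ∈ V₁) (h₂ : ∀ e ∈ (↑E₂ : Set (Sym2 V)), ∀ z ∈ e, z ∈ V₂)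
    (hK1 : VK ∩ V₁ ⊆ ({u} : Set V)) (h12 : V₁ ∩ V₂ ⊆ ({w} : Set V)) (hK2 : VK ∩ V₂ ⊆ ({v} : Set V))
    (hv1 : v ∉ V₁) (huv : u ≠ v) (huw : u ≠ w) (hvw : v ≠ w)
    (hb1 : b ∉ V₁) (hb2 : b ∉ V₂) (hsK : s ∉ VK) (hs2 : s ∉ V₂) (htK : t ∉ VK) (ht1 : t ∉ V₁)
    (hbu : b ≠ u) (hbv : b ≠ v) (hsu : s ≠ u) (hsv : s ≠ v) (hsw : s ≠ w) (htv : t ≠ v) (htw : t ≠ w)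
    (hbs : b ≠ s) (hbt : b ≠ t) (hst : s ≠ t)
    (hKsp : IsTTSP EK v u) (h1sp : IsTTSP E₁ u w) (h2sp : IsTTSP E₂ w v)
    (hbK : ∃ e ∈ EK, b ∈ e) (hs1 : ∃ e ∈ E₁, s ∈ e) (ht2 : ∃ e ∈ E₂, t ∈ e)
    (lam : ℕ) : 0 ≤ ((16 : ℕ) : ℤ) * lev2 (EK ∪ E₁ ∪ E₂) b s t starSTab lam := by
  obtain ⟨e, he, hwe⟩ := h1sp.right_mem
  have hwV1 : w ∈ V₁ := h₁ e he w hwe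
  have hwK : w ∉ VK := fun hw => huw (by have := hK1 ⟨hw, hwV1⟩; simpa using this.symm)
  have hbw : b ≠ w := fun hbw => hb1 (hbw ▸ hwV1)
  have h := ringStar_level_nonneg hdK2.symm hd12.symm hdK1 h₂ hK h₁ (by rwa [Set.inter_comm]) hK1 (by rwa [Set.inter_comm])
    hv1 hwK hvw huv.symm huw.symm htK ht1 hb2 hb1 hs2 hsK htv htw hbv hbw hbu hsv hsw hsu (Ne.symm hbt) (Ne.symm hst) hbs
    h2sp hKsp h1sp ht2 hbK hs1 lam
  have hG : E₂ ∪ EK ∪ E₁ = EK ∪ E₁ ∪ E₂ := by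
    rw [Finset.union_comm E₂ EK, Finset.union_assoc, Finset.union_comm E₂ E₁, ← Finset.union_assoc]
  rwa [hG, lev2_swap_xy, lev2_swap_ys, mirror23_mirror2_starXTab] at h

end RingApex

/-! ### STAR for every nonnegative level weight (census g36) -/

section StarWeights

open scoped Classical

variable {V : Type*} [Fintype V]

/-- **THEOREM SP (THETA, STAR apex `b`) for every nonnegative level weight**: `0 ≤ mval2 w (E_K ∪ E₁ ∪ E₂) b s t starXTab`. [folklore] -/
theorem theta_mval2_star_nonneg {EK E₁ E₂ : Finset (Sym2 V)} {VK V₁ V₂ : Set V} {u v b s t : V}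
    (hdK1 : Disjoint EK E₁) (hdK2 : Disjoint EK E₂) (hd12 : Disjoint E₁ E₂)
    (hK : ∀ e ∈ (↑EK : Set (Sym2 V)), ∀ z ∈ e, z ∈ VK)
    (h₁ : ∀ e ∈ (↑E₁ : Set (Sym2 V)), ∀ z ∈ e, z ∈ V₁) (h₂ : ∀ e ∈ (↑E₂ : Set (Sym2 V)), ∀ z ∈ e, z ∈ V₂)
    (hK1 : VK ∩ V₁ ⊆ ({u, v} : Set V)) (hK2 : VK ∩ V₂ ⊆ ({u, v} : Set V)) (h12 : V₁ ∩ V₂ ⊆ ({u, v} : Set V)) (huv : u ≠ v)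
    (hb1 : b ∉ V₁) (hb2 : b ∉ V₂) (hsK : s ∉ VK) (hs2 : s ∉ V₂) (htK : t ∉ VK) (ht1 : t ∉ V₁)
    (hbu : b ≠ u) (hbv : b ≠ v) (hsu : s ≠ u) (hsv : s ≠ v) (htu : t ≠ u) (htv : t ≠ v)
    (hbs : b ≠ s) (hbt : b ≠ t) (hst : s ≠ t)
    (hKsp : IsTTSP EK u v) (h1sp : IsTTSP E₁ u v) (h2sp : IsTTSP E₂ u v)
    (hbK : ∃ e ∈ EK, b ∈ e) (hs1 : ∃ e ∈ E₁, s ∈ e) (ht2 : ∃ e ∈ E₂, t ∈ e) {w : ℕ → ℝ} (hw : ∀ n, 0 ≤ w n) :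
    0 ≤ mval2 w (EK ∪ E₁ ∪ E₂) b s t starXTab := by
  have hl := thetaStar_level_nonneg hdK1 hdK2 hd12 hK h₁ h₂ hK1 hK2 h12 huv hb1 hb2 hsK hs2 htK ht1 hbu hbv hsu hsv htu htv
    hbs hbt hst hKsp h1sp h2sp hbK hs1 ht2
  exact mval2_nonneg_of_lev2 (fun μ => by simpa using hl μ) hw

/-- **THEOREM SP (RING, STAR apex `b`) for every nonnegative level weight**: `0 ≤ mval2 w (E_K ∪ E₁ ∪ E₂) b s t starXTab`. [folklore] -/
theorem ring_mval2_star_nonneg {EK E₁ E₂ : Finset (Sym2 V)} {VK V₁ V₂ : Set V} {u v w b s t : V}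
    (hdK1 : Disjoint EK E₁) (hdK2 : Disjoint EK E₂) (hd12 : Disjoint E₁ E₂)
    (hK : ∀ e ∈ (↑EK : Set (Sym2 V)), ∀ z ∈ e, z ∈ VK)
    (h₁ : ∀ e ∈ (↑E₁ : Set (Sym2 V)), ∀ z ∈ e, z ∈ V₁) (h₂ : ∀ e ∈ (↑E₂ : Set (Sym2 V)), ∀ z ∈ e, z ∈ V₂)
    (hK1 : VK ∩ V₁ ⊆ ({u} : Set V)) (h12 : V₁ ∩ V₂ ⊆ ({w} : Set V)) (hK2 : VK ∩ V₂ ⊆ ({v} : Set V))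
    (hu2 : u ∉ V₂) (hv1 : v ∉ V₁) (huv : u ≠ v) (huw : u ≠ w) (hvw : v ≠ w)
    (hb1 : b ∉ V₁) (hb2 : b ∉ V₂) (hsK : s ∉ VK) (hs2 : s ∉ V₂) (htK : t ∉ VK) (ht1 : t ∉ V₁)
    (hbu : b ≠ u) (hbv : b ≠ v) (hsu : s ≠ u) (hsv : s ≠ v) (hsw : s ≠ w) (htu : t ≠ u) (htv : t ≠ v) (htw : t ≠ w)
    (hbs : b ≠ s) (hbt : b ≠ t) (hst : s ≠ t)
    (hKsp : IsTTSP EK v u) (h1sp : IsTTSP E₁ u w) (h2sp : IsTTSP E₂ w v)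
    (hbK : ∃ e ∈ EK, b ∈ e) (hs1 : ∃ e ∈ E₁, s ∈ e) (ht2 : ∃ e ∈ E₂, t ∈ e) {wt : ℕ → ℝ} (hw : ∀ n, 0 ≤ wt n) :
    0 ≤ mval2 wt (EK ∪ E₁ ∪ E₂) b s t starXTab := by
  have hl := ringStar_level_nonneg hdK1 hdK2 hd12 hK h₁ h₂ hK1 h12 hK2 hu2 hv1 huv huw hvw hb1 hb2 hsK hs2 htK ht1 hbu hbv
    hsu hsv hsw htu htv htw hbs hbt hst hKsp h1sp h2sp hbK hs1 ht2
  exact mval2_nonneg_of_lev2 (fun μ => by simpa using hl μ) hw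

end StarWeights

end FK

end Summit.CriticalPhenomena.PercolationContinuityZ3.Theorems

end
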